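import Summits.CriticalPhenomena.SAWScalingLimit.Theses.SAWFrontierHomotopy
import Summits.CriticalPhenomena.SAWScalingLimit.Theorems.SubseqIdentification.Negative.ReversalLattice
import Summits.CriticalPhenomena.SAWScalingLimit.Theorems.SAWLoopFugacityFlowIsingBoundaryRatioRestrictionMapAtInfty
import Summits.CriticalPhenomena.SAWScalingLimit.Theorems.SAWFrontierHomotopyOneSidedPowerLawSwapUniformizer
import Literature.Probability.RandomPlanarGeometry.RectangleConformalMap
import Summits.CriticalPhenomena.SAWScalingLimit.Theorems.SAWFrontierHomotopyOneSidedPowerLawPentagonWitness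
import Summits.CriticalPhenomena.SAWScalingLimit.Theorems.SAWFrontierHomotopyOneSidedPowerLawExponentRigidity
import Summits.CriticalPhenomena.SAWScalingLimit.Theorems.SAWFrontierHomotopyOneSidedPowerLawOfAvoidanceLimit
import Summits.CriticalPhenomena.SAWScalingLimit.Theorems.SAWFrontierHomotopyOneSidedPowerLawDatumCanonical

/-!
# Birth skeleton (`Lines/birth.lean`, BC3) for the crux `OneSidedPowerLaw` of route `SAWFrontierHomotopy`
(item stmt-CriticalPhenomena-10702, rank 2)

Crux: `Summit.CriticalPhenomena.SAWScalingLimit.Theses.SAWFrontierHomotopy.OneSidedPowerLaw` — ONE exponent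
`α` such that for every Dobrushin domain `(D; a, b)`, endpoint approximation, hull subdomain `D'` of `D`,
chordal uniformizer `φ` of `D` whose pulled-back hull `A = closure (ℍ ∖ φ⁻¹ D')` is a plus- OR a minus-hull,
and restriction data `(Φ, d = Φ'_A(0))`: `P_δ[range γ_δ ⊆ closure D'] → d ^ α` as `δ → 0+`.

## The line = the ROUTE'S OWN two-layer plan for this crux, typed

Route header, TWO-LAYER PLAN: "OneSidedPowerLaw ⇐ OneSidedContinuationAtZero (plus-hulls, s = 0 instance of
rank-3 OneSidedContinuation) → ReversalSymmetry (law (D; b, a) = reverse_* law (D; a, b), exact; plus-hulls of the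
swapped domain = minus-hulls) → OneSidedPowerLaw"; crux text: "Minus-hulls follow from plus-hulls by exact SAW
reversal, so the mechanism only has to deliver the plus side." The mechanism cruxes (OneSidedContinuation,
FrontierAnchor) are still informal (definition requests RightFrontierSAW / FrontierTiltedSAWLaw /
SLEKappaRhoCurveLaw have not landed: `lean search 'rightFrontier|FrontierTilted'` ∅, 2026-08-17), so the s = 0
endpoint is typed as ONE stub over existing declarations and the reversal is split into its three parts, of which
two are ALREADY in the tree and are discharged in the glue:

* lattice half — exact reversibility of the `x_c`-SAW law at every mesh,
  `Theorems.SubseqIdentification.Negative.map_curve_law_swap` / `isEndpointApprox_swap` (landed, sorry-free), with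
  `CurveClass.map_reverse_apply` + `CurveClass.preimage_reverse_rangeSubset` (the avoidance event is reversal
  invariant);
* restriction-map half — the inversion `ι(z) = -1/z` carries restriction data of `A` to restriction data of
  `invHull A` with the SAME `d = Φ'_A(0)` (`Theorems.IsingBoundaryRatio.isRestrictionMap_invertedMap`,
  `isStarHull_invHull`, landed), and `𝒬₋ ↦ 𝒬₊` under `ι` (sign of real points, proved here);
* conformal-geometry half — NOT in the tree, the second stub: `ι` intertwines the chordal uniformizers of
  `(D; a, b)` and of the swapped Dobrushin domain `D.swap = (D; b, a)` and inverts pulled-back hulls.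

Registered stubs (2 of the plan + 2 negative-knowledge exports of lead c3, §6; after wave 1 of the first lead,
2026-08-17: stub 2 CLOSED — landed as `Theorems/SAWFrontierHomotopyOneSidedPowerLawSwapUniformizer.lean`, p148963 —
so that `oneSidedPowerLaw_iff_stub_plusPowerLaw` below shows the crux is EQUIVALENT to `stub_plusPowerLaw`; lead c3
added `stub_pentagonWitness` / `stub_exponentRigidity` (§6), which prove that the exponent of the crux AND of the
open stub is UNIQUE and POSITIVE, and `stub_ofAvoidanceLimit` (§7, necessity); lead c4 added `stub_datumCanonical`
(§8, landed p161413): the conformal data `(φ, Φ, d)` of the crux are CANONICAL per configuration `(D, D')`, so the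
only quantifiers of the open stub carrying content are the lattice ones — `D`, `D'`, the endpoint approximation):

* `stub_plusPowerLaw` — the crux for PLUS-hulls only (`OneSidedPowerLawPlus`; = OneSidedContinuationAtZero of the
  two-layer plan): XL, open-problem, the HARDEST (it is the s = 0 end of the route's tilt homotopy; conformal
  invariance of one-sided SAW hull-avoidance in pure-power form). Strictly weaker than the crux as a statement
  (`plus_of_oneSided` below is the trivial converse), NOT cheaply equivalent to it: the way back is the reversal.
* `stub_swapUniformizer` — (`SwapUniformizer`) for every Dobrushin `D`, `D'`, chordal uniformizer `φ` of `D` whose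
  pulled-back hull `A = closure (ℍ ∖ {z ∈ ℍ | φ z ∈ D'})` is a `*`-hull, there is a chordal uniformizer `φ'` of
  `D.swap` whose pulled-back hull of `D'` is EXACTLY `invHull A = {w | -1/w ∈ A}`. Intended proof:
  `φ' = invEquivUpperHalfPlane.trans φ` (`φ ∘ ι`); boundary values `0 ↦ b`, `∞ ↦ a` by
  `tendsto_neg_inv_nhdsWithin_zero` / `tendsto_neg_inv_cocompact_inf`; `ℍ ∖ φ'⁻¹D' = ι(ℍ ∖ φ⁻¹D')` pointwise, and
  `closure ∘ ι = ι ∘ closure` on sets whose closure is compact and misses `0` (here: `A` is a `*`-hull). Size M.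

PROVED here (no `sorry`): `isPlusHull_invHull_of_isMinusHull`, `hullClauses_swap`, `tendsto_minus_of_plus` (the
minus-hull case from the plus-hull law in the swapped domain + exact lattice reversal) and the composition
`OneSidedPowerLaw_of : stub_plusPowerLaw → OneSidedPowerLaw` (stub_swapUniformizer discharged inside since it
landed; obtain `α` from the plus law;
plus-hulls directly; minus-hulls through `tendsto_minus_of_plus`).

Disproof.lean: none exists for this crux yet (`ledger crux ls stmt-CriticalPhenomena-10702`: no workfiles,
2026-08-17). Negatives index respected: no all-`δ` tightness is used anywhere (cf. refuted stmt-CriticalPhenomena-0772).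

Sources: LawlerSchrammWerner2003Restriction (arXiv:math/0209343 §2: `𝒬₋ = σ(𝒬₊)`; §8 one-sided restriction);
LawlerSchrammWerner2004SAW §2.2 (symmetry `P(z,w;D) = P(w,z;D)`), §3.1 (`β^{-|ω|}` reversal invariant);
Kennedy arXiv:math/0112246 (one-sided half-plane tests of `Φ'_A(0)^{5/8}`).
-/

noncomputable section

open scoped Topology ENNReal NNReal
open Filter Set MeasureTheory
open UpperHalfPlane (upperHalfPlaneSet)
open Literature.Probability.RandomPlanarGeometry Literature.Probability.LatticeModels
open Summit.CriticalPhenomena.SAWScalingLimit.Theses.SAWFrontierHomotopy (OneSidedPowerLaw)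
open Summit.CriticalPhenomena.SAWScalingLimit.Theses.SAWLoopFugacityFlow (AvoidanceLimit)

namespace Summit.CriticalPhenomena.SAWScalingLimit.Cruxes.OneSidedPowerLaw.Birth

/-! ## 1. The statements of the line (over landed declarations only) -/

/-- **The one-sided power law for PLUS-hulls with exponent `α`**: the body of the crux with the disjunction
`IsPlusHull A ∨ IsMinusHull A` specialised to its first branch (hulls attached to the boundary arc `(0, ∞)`,
i.e. to the arc of `∂D` from `a` to `b` on the `φ(ℝ₊)` side). [cite: LawlerSchrammWerner2003Restriction, §8] -/
def PlusPowerLaw (α : ℝ) : Prop :=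
  ∀ (D : DobrushinDomain) (a b : ℝ → Site 2), SAW.IsEndpointApprox D a b →
    ∀ (D' : DobrushinDomain), (D'.carrier ⊆ D.carrier ∧ D'.pt 0 = D.pt 0 ∧ D'.pt 1 = D.pt 1 ∧
      D.pt 0 ∉ closure (D.carrier \ D'.carrier) ∧ D.pt 1 ∉ closure (D.carrier \ D'.carrier)) →
    ∀ (φ : ConformalEquiv upperHalfPlaneSet D.carrier), D.IsChordalUniformizing φ →
    IsPlusHull (closure (upperHalfPlaneSet \ {z : ℂ | z ∈ upperHalfPlaneSet ∧ φ z ∈ D'.carrier})) →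
    ∀ (Φ : ConformalEquiv (upperHalfPlaneSet \ closure (upperHalfPlaneSet \
        {z : ℂ | z ∈ upperHalfPlaneSet ∧ φ z ∈ D'.carrier})) upperHalfPlaneSet) (d : ℝ),
      IsRestrictionMap (closure (upperHalfPlaneSet \ {z : ℂ | z ∈ upperHalfPlaneSet ∧ φ z ∈ D'.carrier})) Φ →
      HasRestrictionDeriv (closure (upperHalfPlaneSet \ {z : ℂ | z ∈ upperHalfPlaneSet ∧ φ z ∈ D'.carrier})) Φ d →
      Tendsto (fun δ => ((SAW.law D.carrier δ (a δ) (b δ)).map (fun γ => γ.curve))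
        (CurveClass.rangeSubset (closure D'.carrier))) (𝓝[>] 0) (𝓝 (ENNReal.ofReal (d ^ α)))

/-- **OneSidedContinuationAtZero / the plus-hull power law** (stub 1, XL, open): ONE exponent `α` serving every
plus-hull datum. Conjecturally `α = 5/8`; the value is never used. [cite: LawlerSchrammWerner2004SAW, §4.1 Prediction 1]
[cite: arXiv:math/0112246] -/
def OneSidedPowerLawPlus : Prop :=
  ∃ α : ℝ, PlusPowerLaw α

/-- **SwapUniformizer** (stub 2, M, provable now — the conformal-geometry half of ReversalSymmetry): the inversion
`ι(z) = -1/z` of `ℍ` exchanges the boundary points `0` and `∞`, so `φ ∘ ι` uniformizes the SWAPPED Dobrushin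
domain `D.swap = (D; b, a)` (`MarkedDomain.swap`), and the pulled-back hull of `D'` under it is the inverted hull
`invHull A` of the pulled-back hull `A` of `D'` under `φ` (closure commutes with `ι` because `A` is a `*`-hull:
compact and off `0`). Stated as an existence so that no particular `ConformalEquiv` term is frozen into the
registered signature. [cite: LawlerSchrammWerner2003Restriction, §2 p. 8 (𝒬₋ = σ(𝒬₊))] -/
def SwapUniformizer : Prop :=
  ∀ (D D' : DobrushinDomain) (φ : ConformalEquiv upperHalfPlaneSet D.carrier), D.IsChordalUniformizing φ →
    IsStarHull (closure (upperHalfPlaneSet \ {z : ℂ | z ∈ upperHalfPlaneSet ∧ φ z ∈ D'.carrier})) →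
    ∃ φ' : ConformalEquiv upperHalfPlaneSet D.swap.carrier, D.swap.IsChordalUniformizing φ' ∧
      closure (upperHalfPlaneSet \ {z : ℂ | z ∈ upperHalfPlaneSet ∧ φ' z ∈ D'.carrier}) =
        invHull (closure (upperHalfPlaneSet \ {z : ℂ | z ∈ upperHalfPlaneSet ∧ φ z ∈ D'.carrier}))

/-! ## 2. Registered stubs -/

/-! The `stub_*` theorems are the registered obligations (sorried; statements LITERAL so that the registered
signatures are self-contained); `Registered.stub_*` are the name-keyed `abbrev` aliases of their statements, used
as the hypotheses of `OneSidedPowerLaw_of` (the skeleton audit admits a hypothesis whose head's last name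
component is a declared stub). -/
namespace Registered

abbrev stub_plusPowerLaw : Prop := OneSidedPowerLawPlus
abbrev stub_swapUniformizer : Prop := SwapUniformizer

end Registered

/-- STUB 1 (XL, HARDEST — the s = 0 end of the route's homotopy): the plus-hull power law
(`OneSidedPowerLawPlus`, literal). -/
theorem stub_plusPowerLaw :
    ∃ α : ℝ, ∀ (D : DobrushinDomain) (a b : ℝ → Site 2), SAW.IsEndpointApprox D a b →
      ∀ (D' : DobrushinDomain), (D'.carrier ⊆ D.carrier ∧ D'.pt 0 = D.pt 0 ∧ D'.pt 1 = D.pt 1 ∧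
        D.pt 0 ∉ closure (D.carrier \ D'.carrier) ∧ D.pt 1 ∉ closure (D.carrier \ D'.carrier)) →
      ∀ (φ : ConformalEquiv upperHalfPlaneSet D.carrier), D.IsChordalUniformizing φ →
      IsPlusHull (closure (upperHalfPlaneSet \ {z : ℂ | z ∈ upperHalfPlaneSet ∧ φ z ∈ D'.carrier})) →
      ∀ (Φ : ConformalEquiv (upperHalfPlaneSet \ closure (upperHalfPlaneSet \
          {z : ℂ | z ∈ upperHalfPlaneSet ∧ φ z ∈ D'.carrier})) upperHalfPlaneSet) (d : ℝ),
        IsRestrictionMap (closure (upperHalfPlaneSet \ {z : ℂ | z ∈ upperHalfPlaneSet ∧ φ z ∈ D'.carrier})) Φ →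
        HasRestrictionDeriv (closure (upperHalfPlaneSet \ {z : ℂ | z ∈ upperHalfPlaneSet ∧ φ z ∈ D'.carrier})) Φ d →
        Tendsto (fun δ => ((SAW.law D.carrier δ (a δ) (b δ)).map (fun γ => γ.curve))
          (CurveClass.rangeSubset (closure D'.carrier))) (𝓝[>] 0) (𝓝 (ENNReal.ofReal (d ^ α))) := by
  sorry

/-- STUB 2 (M) — CLOSED 2026-08-17 (wave 1, p148963,
`Theorems.OneSidedPowerLaw.stub_swapUniformizer`): the inversion `z ↦ -1/z` intertwines the chordal uniformizers
of `(D; a, b)` and `(D; b, a)` and inverts pulled-back hulls (`SwapUniformizer`, literal). -/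
theorem stub_swapUniformizer :
    ∀ (D D' : DobrushinDomain) (φ : ConformalEquiv upperHalfPlaneSet D.carrier), D.IsChordalUniformizing φ →
      IsStarHull (closure (upperHalfPlaneSet \ {z : ℂ | z ∈ upperHalfPlaneSet ∧ φ z ∈ D'.carrier})) →
      ∃ φ' : ConformalEquiv upperHalfPlaneSet D.swap.carrier, D.swap.IsChordalUniformizing φ' ∧
        closure (upperHalfPlaneSet \ {z : ℂ | z ∈ upperHalfPlaneSet ∧ φ' z ∈ D'.carrier}) =
          invHull (closure (upperHalfPlaneSet \ {z : ℂ | z ∈ upperHalfPlaneSet ∧ φ z ∈ D'.carrier})) :=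
  -- LANDED (wave 1, p148963): `Theorems/SAWFrontierHomotopyOneSidedPowerLawSwapUniformizer.lean`
  Theorems.OneSidedPowerLaw.stub_swapUniformizer

/-! The literal stubs are, by `Iff.rfl`, the named statements of §1. -/
example : OneSidedPowerLawPlus := stub_plusPowerLaw
example : SwapUniformizer := stub_swapUniformizer

/-! ## 3. Glue (sorry-free) -/

/-- **`ι` maps `𝒬₋` to `𝒬₊`**: the inverted hull of a minus-hull is a plus-hull (`*`-hull by the landed
`isStarHull_invHull`; a real point `x` of `invHull A` has `-1/x ∈ A ∩ ℝ ⊂ (-∞, 0)`, so `x > 0`).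
[cite: LawlerSchrammWerner2003Restriction, §2 p. 8] -/
theorem isPlusHull_invHull_of_isMinusHull {A : Set ℂ} (hA : IsMinusHull A) : IsPlusHull (invHull A) := by
  refine ⟨Theorems.IsingBoundaryRatio.isStarHull_invHull hA.1, fun x hx => ?_⟩
  have hneg : -x⁻¹ < 0 := hA.2 (-x⁻¹) (by
    rw [Complex.ofReal_neg, Complex.ofReal_inv]
    exact mem_invHull_iff.1 hx)
  have hpos : 0 < x⁻¹ := by linarith
  exact inv_pos.1 hpos

/-- The five hull-subdomain clauses of the crux pass to the swapped pair `(D.swap, D'.swap)` (same carriers,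
marked points exchanged). [folklore] -/
theorem hullClauses_swap {D D' : DobrushinDomain}
    (h : D'.carrier ⊆ D.carrier ∧ D'.pt 0 = D.pt 0 ∧ D'.pt 1 = D.pt 1 ∧
      D.pt 0 ∉ closure (D.carrier \ D'.carrier) ∧ D.pt 1 ∉ closure (D.carrier \ D'.carrier)) :
    D'.swap.carrier ⊆ D.swap.carrier ∧ D'.swap.pt 0 = D.swap.pt 0 ∧ D'.swap.pt 1 = D.swap.pt 1 ∧
      D.swap.pt 0 ∉ closure (D.swap.carrier \ D'.swap.carrier) ∧
      D.swap.pt 1 ∉ closure (D.swap.carrier \ D'.swap.carrier) := by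
  obtain ⟨h1, h2, h3, h4, h5⟩ := h
  simp only [MarkedDomain.carrier_swap, MarkedDomain.pt_swap_zero, MarkedDomain.pt_swap_one]
  exact ⟨h1, h3, h2, h5, h4⟩

/-- **The minus-hull case from the plus-hull law (ReversalSymmetry, assembled).** Given the plus-hull power law
with exponent `α` and `SwapUniformizer`: for a MINUS pulled-back hull `A` with restriction data `(Φ, d)`,
`d > 0` (`IsStarHull.exists_hasRestrictionDeriv_holds` + uniqueness), the inverted hull `invHull A` is a plus-hull
with restriction data `(invertedMap Φ d _ 0, d)` (landed `isRestrictionMap_invertedMap`), it IS the pulled-back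
hull of `D'.swap` under the swapped uniformizer `φ'` (stub 2), so the plus-hull law in `(D.swap; b, a)` gives
`P^{(b,a)}_δ[range ⊆ closure D'] → d ^ α`; and `P^{(b,a)}_δ = reverse_* P^{(a,b)}_δ` EXACTLY at every mesh
(landed `map_curve_law_swap`) with `{range ⊆ closure D'}` reversal invariant. [cite: LawlerSchrammWerner2004SAW, §2.2 and §3.1] -/
theorem tendsto_minus_of_plus {α : ℝ} (hP : PlusPowerLaw α) (hS : SwapUniformizer)
    {D : DobrushinDomain} {a b : ℝ → Site 2} (hab : SAW.IsEndpointApprox D a b) {D' : DobrushinDomain}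
    (hsub : D'.carrier ⊆ D.carrier ∧ D'.pt 0 = D.pt 0 ∧ D'.pt 1 = D.pt 1 ∧
      D.pt 0 ∉ closure (D.carrier \ D'.carrier) ∧ D.pt 1 ∉ closure (D.carrier \ D'.carrier))
    {φ : ConformalEquiv upperHalfPlaneSet D.carrier} (hφ : D.IsChordalUniformizing φ)
    (hminus : IsMinusHull (closure (upperHalfPlaneSet \ {z : ℂ | z ∈ upperHalfPlaneSet ∧ φ z ∈ D'.carrier})))
    {Φ : ConformalEquiv (upperHalfPlaneSet \ closure (upperHalfPlaneSet \
        {z : ℂ | z ∈ upperHalfPlaneSet ∧ φ z ∈ D'.carrier})) upperHalfPlaneSet} {d : ℝ}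
    (hΦ : IsRestrictionMap (closure (upperHalfPlaneSet \ {z : ℂ | z ∈ upperHalfPlaneSet ∧ φ z ∈ D'.carrier})) Φ)
    (hd : HasRestrictionDeriv (closure (upperHalfPlaneSet \ {z : ℂ | z ∈ upperHalfPlaneSet ∧ φ z ∈ D'.carrier})) Φ d) :
    Tendsto (fun δ => ((SAW.law D.carrier δ (a δ) (b δ)).map (fun γ => γ.curve))
      (CurveClass.rangeSubset (closure D'.carrier))) (𝓝[>] 0) (𝓝 (ENNReal.ofReal (d ^ α))) := by
  have hstar : IsStarHull (closure (upperHalfPlaneSet \ {z : ℂ | z ∈ upperHalfPlaneSet ∧ φ z ∈ D'.carrier})) :=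
    hminus.1
  -- `0 < d`
  obtain ⟨d', hd'0, -, hd'⟩ := IsStarHull.exists_hasRestrictionDeriv_holds hstar hΦ
  have hdpos : 0 < d := by rwa [hd.unique hstar hd']
  -- the inverted hull is a plus-hull with restriction data `(Ψ, d)`
  have hplus' := isPlusHull_invHull_of_isMinusHull hminus
  have hΨ := Theorems.IsingBoundaryRatio.isRestrictionMap_invertedMap hΦ hd hdpos
  -- the swapped uniformizer, whose pulled-back hull of `D'` IS the inverted hull
  obtain ⟨φ', hφ', hEq⟩ := hS D D' φ hφ hstar
  have key : ∀ B : Set ℂ,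
      B = invHull (closure (upperHalfPlaneSet \ {z : ℂ | z ∈ upperHalfPlaneSet ∧ φ z ∈ D'.carrier})) →
      IsPlusHull B ∧ ∃ Ψ : ConformalEquiv (upperHalfPlaneSet \ B) upperHalfPlaneSet,
        IsRestrictionMap B Ψ ∧ HasRestrictionDeriv B Ψ d := by
    rintro B rfl
    exact ⟨hplus', _, hΨ.1, hΨ.2⟩
  obtain ⟨hBplus, Ψ, hΨ1, hΨ2⟩ := key _ hEq
  -- the plus-hull power law in the swapped domain `(D.swap; b, a)`
  have hT := hP D.swap b a (Theorems.SubseqIdentification.Negative.isEndpointApprox_swap hab) D'.swap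
    (hullClauses_swap hsub) φ' hφ' hBplus Ψ d hΨ1 hΨ2
  -- exact lattice reversibility: the avoidance event has the same mass under `P^{(a,b)}_δ` and `P^{(b,a)}_δ`
  refine hT.congr fun δ => ?_
  show ((SAW.law D.carrier δ (b δ) (a δ)).map (fun γ => γ.curve)) (CurveClass.rangeSubset (closure D'.carrier)) =
    ((SAW.law D.carrier δ (a δ) (b δ)).map (fun γ => γ.curve)) (CurveClass.rangeSubset (closure D'.carrier))
  rw [Theorems.SubseqIdentification.Negative.map_curve_law_swap (Ω := D.carrier) (δ := δ) (a := a δ) (b := b δ),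
    CurveClass.map_reverse_apply, CurveClass.preimage_reverse_rangeSubset]

/-! ## 4. The composition: the registered stubs imply the crux, BY NAME -/

/-- **`OneSidedPowerLaw_of` (kernel-checked, no `sorry`): stub_plusPowerLaw →
`SAWFrontierHomotopy.OneSidedPowerLaw`** (stub_swapUniformizer, formerly the second hypothesis, is discharged
inside the proof since it landed as p148963). The exponent is the plus-hull exponent; plus-hulls are served by stub 1
directly, minus-hulls by `tendsto_minus_of_plus` (stub 2 + the landed inversion of restriction data + the landed
exact lattice reversibility of the critical SAW law). -/
theorem OneSidedPowerLaw_of (h₁ : Registered.stub_plusPowerLaw) : OneSidedPowerLaw := by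
  -- stub 2 is DISCHARGED (landed p148963): no second hypothesis since the reshape of 2026-08-17
  have h₂ : Registered.stub_swapUniformizer := stub_swapUniformizer
  obtain ⟨α, hP⟩ := h₁
  refine ⟨α, ?_⟩
  intro D a b hab D' hsub φ hφ hside Φ d hΦ hd
  rcases hside with hplus | hminus
  · exact hP D a b hab D' hsub φ hφ hplus Φ d hΦ hd
  · exact tendsto_minus_of_plus hP h₂ hab hsub hφ hminus hΦ hd

/-- Hypothesis-free form: the crux modulo the one remaining sorried stub. -/
example : OneSidedPowerLaw := OneSidedPowerLaw_of stub_plusPowerLaw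

/-! ## 5. Sanity: the hardest stub is a CONSEQUENCE of the crux (so it is not stronger than the crux), and the
skeleton's second stub is what separates them. -/

/-- The plus-hull law is the `IsPlusHull` branch of the crux (trivial direction). -/
theorem plus_of_oneSided (h : OneSidedPowerLaw) : OneSidedPowerLawPlus := by
  obtain ⟨α, hα⟩ := h
  exact ⟨α, fun D a b hab D' hsub φ hφ hplus Φ d hΦ hd => hα D a b hab D' hsub φ hφ (Or.inl hplus) Φ d hΦ hd⟩

/-- **After wave 1 the crux is EQUIVALENT to the one open stub** (kernel-checked, no `sorry`,
no hypothesis): with `stub_swapUniformizer` landed (`Theorems.OneSidedPowerLaw.stub_swapUniformizer`,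
p148963), `OneSidedPowerLaw ↔ Registered.stub_plusPowerLaw`. So `stub_plusPowerLaw` is exactly
crux-sized: no reshaping inside this line can make it smaller than the crux itself. -/
theorem oneSidedPowerLaw_iff_stub_plusPowerLaw : OneSidedPowerLaw ↔ Registered.stub_plusPowerLaw :=
  ⟨plus_of_oneSided, OneSidedPowerLaw_of⟩

/-! ## 6. Negative knowledge on the `∃ α` (lead c3, 2026-08-17): the exponent of the crux — and of the open
stub — is RIGID (unique) and POSITIVE. Two further REGISTERED stubs, definition-free restatements of the
exports of the support files `Theorems/SAWFrontierHomotopyOneSidedPowerLawPentagonWitness.lean`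
(`stub_pentagonWitness`: the two pentagons `P±` of `bigSq = ((-2,2)²; 2, -2)` as Dobrushin domains) and
`Theorems/SAWFrontierHomotopyOneSidedPowerLawExponentRigidity.lean` (`stub_exponentRigidity`: disjoint one-sided
avoidance events give `d₊ ^ α + d₋ ^ α ≤ 1`, hence `α > 0`, and `restrictionDeriv_lt_one` gives uniqueness),
both built on the landed Literature lemma `isPlusHull_or_isMinusHull_pullbackHull` (p156867). Both LANDED
(p157695, p158200) and are discharged below; the corollaries transfer them to the line's open stub through the
per-exponent form of the composition (`cruxBody_of_plusPowerLaw`): `stub_plusPowerLaw ↔ ∃! α, PlusPowerLaw α`,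
and that `α` is `> 0`. -/

/-- The crux body at a fixed exponent `α` (the crux is `∃ α, CruxBody α`, `Iff.rfl`). -/
def CruxBody (α : ℝ) : Prop :=
  ∀ (D : DobrushinDomain) (a b : ℝ → Site 2), SAW.IsEndpointApprox D a b →
    ∀ (D' : DobrushinDomain), (D'.carrier ⊆ D.carrier ∧ D'.pt 0 = D.pt 0 ∧ D'.pt 1 = D.pt 1 ∧
      D.pt 0 ∉ closure (D.carrier \ D'.carrier) ∧ D.pt 1 ∉ closure (D.carrier \ D'.carrier)) →
    ∀ (φ : ConformalEquiv upperHalfPlaneSet D.carrier), D.IsChordalUniformizing φ →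
    (IsPlusHull (closure (upperHalfPlaneSet \ {z : ℂ | z ∈ upperHalfPlaneSet ∧ φ z ∈ D'.carrier})) ∨
      IsMinusHull (closure (upperHalfPlaneSet \ {z : ℂ | z ∈ upperHalfPlaneSet ∧ φ z ∈ D'.carrier}))) →
    ∀ (Φ : ConformalEquiv (upperHalfPlaneSet \ closure (upperHalfPlaneSet \
        {z : ℂ | z ∈ upperHalfPlaneSet ∧ φ z ∈ D'.carrier})) upperHalfPlaneSet) (d : ℝ),
      IsRestrictionMap (closure (upperHalfPlaneSet \ {z : ℂ | z ∈ upperHalfPlaneSet ∧ φ z ∈ D'.carrier})) Φ →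
      HasRestrictionDeriv (closure (upperHalfPlaneSet \ {z : ℂ | z ∈ upperHalfPlaneSet ∧ φ z ∈ D'.carrier})) Φ d →
      Tendsto (fun δ => ((SAW.law D.carrier δ (a δ) (b δ)).map (fun γ => γ.curve))
        (CurveClass.rangeSubset (closure D'.carrier))) (𝓝[>] 0) (𝓝 (ENNReal.ofReal (d ^ α)))

/-- The crux is `∃ α, CruxBody α`, definitionally. -/
theorem oneSidedPowerLaw_iff_exists_cruxBody : OneSidedPowerLaw ↔ ∃ α : ℝ, CruxBody α := Iff.rfl

/-- STUB 3 (S, support data; definition-free) — CLOSED 2026-08-17 (lead c3, p157695,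
`Theorems.OneSidedPowerLaw.Negative.stub_pentagonWitness`): **the pentagon witnesses** — for `ε = ±1` a Dobrushin domain
whose carrier is the open pentagon `{z ∈ (-2,2)² | ε · im z < -1/2 + (5/4)|re z|}`, marked at `2` and `-2`
(polygonal Jordan domain via the tree's Jordan curve theorem, marked by `exists_dobrushinDomain_of_frontier_points`). -/
theorem stub_pentagonWitness : ∀ ε : ℝ, (ε = 1 ∨ ε = -1) →
    ∃ P : DobrushinDomain, P.carrier = {z : ℂ | z ∈ symRect 2 2 ∧ ε * z.im < -1 / 2 + 5 / 4 * |z.re|} ∧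
      P.pt 0 = 2 ∧ P.pt 1 = -2 :=
  -- LANDED (lead c3, p157695): `Theorems/SAWFrontierHomotopyOneSidedPowerLawPentagonWitness.lean`
  Theorems.OneSidedPowerLaw.Negative.stub_pentagonWitness

/-- STUB 4 (M, negative knowledge; definition-free) — CLOSED 2026-08-17 (lead c3, p158200,
`Theorems.OneSidedPowerLaw.Negative.stub_exponentRigidity`): **the exponent is rigid and positive** — if the crux body
holds at `α` then `0 < α`, and every exponent at which the body holds equals `α`. -/
theorem stub_exponentRigidity : ∀ α : ℝ,
    (∀ (D : DobrushinDomain) (a b : ℝ → Site 2), SAW.IsEndpointApprox D a b →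
      ∀ (D' : DobrushinDomain), (D'.carrier ⊆ D.carrier ∧ D'.pt 0 = D.pt 0 ∧ D'.pt 1 = D.pt 1 ∧
        D.pt 0 ∉ closure (D.carrier \ D'.carrier) ∧ D.pt 1 ∉ closure (D.carrier \ D'.carrier)) →
      ∀ (φ : ConformalEquiv upperHalfPlaneSet D.carrier), D.IsChordalUniformizing φ →
      (IsPlusHull (closure (upperHalfPlaneSet \ {z : ℂ | z ∈ upperHalfPlaneSet ∧ φ z ∈ D'.carrier})) ∨
        IsMinusHull (closure (upperHalfPlaneSet \ {z : ℂ | z ∈ upperHalfPlaneSet ∧ φ z ∈ D'.carrier}))) →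
      ∀ (Φ : ConformalEquiv (upperHalfPlaneSet \ closure (upperHalfPlaneSet \
          {z : ℂ | z ∈ upperHalfPlaneSet ∧ φ z ∈ D'.carrier})) upperHalfPlaneSet) (d : ℝ),
        IsRestrictionMap (closure (upperHalfPlaneSet \ {z : ℂ | z ∈ upperHalfPlaneSet ∧ φ z ∈ D'.carrier})) Φ →
        HasRestrictionDeriv (closure (upperHalfPlaneSet \ {z : ℂ | z ∈ upperHalfPlaneSet ∧ φ z ∈ D'.carrier})) Φ d →
        Tendsto (fun δ => ((SAW.law D.carrier δ (a δ) (b δ)).map (fun γ => γ.curve))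
          (CurveClass.rangeSubset (closure D'.carrier))) (𝓝[>] 0) (𝓝 (ENNReal.ofReal (d ^ α)))) →
    0 < α ∧ ∀ β : ℝ,
    (∀ (D : DobrushinDomain) (a b : ℝ → Site 2), SAW.IsEndpointApprox D a b →
      ∀ (D' : DobrushinDomain), (D'.carrier ⊆ D.carrier ∧ D'.pt 0 = D.pt 0 ∧ D'.pt 1 = D.pt 1 ∧
        D.pt 0 ∉ closure (D.carrier \ D'.carrier) ∧ D.pt 1 ∉ closure (D.carrier \ D'.carrier)) →
      ∀ (φ : ConformalEquiv upperHalfPlaneSet D.carrier), D.IsChordalUniformizing φ →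
      (IsPlusHull (closure (upperHalfPlaneSet \ {z : ℂ | z ∈ upperHalfPlaneSet ∧ φ z ∈ D'.carrier})) ∨
        IsMinusHull (closure (upperHalfPlaneSet \ {z : ℂ | z ∈ upperHalfPlaneSet ∧ φ z ∈ D'.carrier}))) →
      ∀ (Φ : ConformalEquiv (upperHalfPlaneSet \ closure (upperHalfPlaneSet \
          {z : ℂ | z ∈ upperHalfPlaneSet ∧ φ z ∈ D'.carrier})) upperHalfPlaneSet) (d : ℝ),
        IsRestrictionMap (closure (upperHalfPlaneSet \ {z : ℂ | z ∈ upperHalfPlaneSet ∧ φ z ∈ D'.carrier})) Φ →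
        HasRestrictionDeriv (closure (upperHalfPlaneSet \ {z : ℂ | z ∈ upperHalfPlaneSet ∧ φ z ∈ D'.carrier})) Φ d →
        Tendsto (fun δ => ((SAW.law D.carrier δ (a δ) (b δ)).map (fun γ => γ.curve))
          (CurveClass.rangeSubset (closure D'.carrier))) (𝓝[>] 0) (𝓝 (ENNReal.ofReal (d ^ β)))) →
    β = α :=
  -- LANDED (lead c3, p158200): `Theorems/SAWFrontierHomotopyOneSidedPowerLawExponentRigidity.lean`
  Theorems.OneSidedPowerLaw.Negative.stub_exponentRigidity

/-! The literal stubs are, by `Iff.rfl`, statements about `CruxBody`. -/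
example : ∀ α : ℝ, CruxBody α → 0 < α ∧ ∀ β : ℝ, CruxBody β → β = α := stub_exponentRigidity

/-- **Per-exponent form of the composition**: the plus-hull law at exponent `α` gives the whole crux body at
`α` (minus-hulls by `tendsto_minus_of_plus` with the landed `stub_swapUniformizer`). -/
theorem cruxBody_of_plusPowerLaw {α : ℝ} (hP : PlusPowerLaw α) : CruxBody α := by
  intro D a b hab D' hsub φ hφ hside Φ d hΦ hd
  rcases hside with hplus | hminus
  · exact hP D a b hab D' hsub φ hφ hplus Φ d hΦ hd
  · exact tendsto_minus_of_plus hP stub_swapUniformizer hab hsub hφ hminus hΦ hd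

/-- Conversely the crux body at `α` contains the plus-hull law at `α`. -/
theorem plusPowerLaw_of_cruxBody {α : ℝ} (h : CruxBody α) : PlusPowerLaw α :=
  fun D a b hab D' hsub φ hφ hplus Φ d hΦ hd => h D a b hab D' hsub φ hφ (Or.inl hplus) Φ d hΦ hd

/-- **The exponent of the open stub is positive**: `PlusPowerLaw α → 0 < α`. -/
theorem plusPowerLaw_exponent_pos {α : ℝ} (hP : PlusPowerLaw α) : 0 < α :=
  (stub_exponentRigidity α (cruxBody_of_plusPowerLaw hP)).1

/-- **The exponent of the open stub is unique**: `PlusPowerLaw α → PlusPowerLaw β → β = α`. -/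
theorem plusPowerLaw_exponent_unique {α β : ℝ} (hα : PlusPowerLaw α) (hβ : PlusPowerLaw β) : β = α :=
  (stub_exponentRigidity α (cruxBody_of_plusPowerLaw hα)).2 β (cruxBody_of_plusPowerLaw hβ)

/-- **Rigid form of the open stub**: `stub_plusPowerLaw ↔ ∃! α, PlusPowerLaw α`. -/
theorem stub_plusPowerLaw_iff_existsUnique : Registered.stub_plusPowerLaw ↔ ∃! α : ℝ, PlusPowerLaw α :=
  ⟨fun ⟨α, hα⟩ => ⟨α, hα, fun _ hβ => plusPowerLaw_exponent_unique hα hβ⟩, fun ⟨α, hα, _⟩ => ⟨α, hα⟩⟩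

/-- **Positive form of the open stub**: `stub_plusPowerLaw ↔ ∃ α > 0, PlusPowerLaw α` — the degenerate
branches `α ≤ 0` of the `∃ α` are excluded unconditionally. -/
theorem stub_plusPowerLaw_iff_exists_pos : Registered.stub_plusPowerLaw ↔ ∃ α : ℝ, 0 < α ∧ PlusPowerLaw α :=
  ⟨fun ⟨α, hα⟩ => ⟨α, plusPowerLaw_exponent_pos hα, hα⟩, fun ⟨α, _, hα⟩ => ⟨α, hα⟩⟩

/-- The same for the crux: `OneSidedPowerLaw ↔ ∃! α, CruxBody α`, and that `α` is positive. -/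
theorem oneSidedPowerLaw_iff_existsUnique_pos :
    OneSidedPowerLaw ↔ ∃! α : ℝ, 0 < α ∧ CruxBody α := by
  rw [oneSidedPowerLaw_iff_exists_cruxBody]
  constructor
  · rintro ⟨α, hα⟩
    exact ⟨α, ⟨(stub_exponentRigidity α hα).1, hα⟩, fun β hβ => (stub_exponentRigidity α hα).2 β hβ.2⟩
  · rintro ⟨α, ⟨-, hα⟩, -⟩
    exact ⟨α, hα⟩

/-! ## 7. Necessity (lead c1's `Lines/birth_necessity.lean`, put into the tree by lead c3): the crux is BELOW the
closed-range avoidance crux `AvoidanceLimit` of route SAWLoopFugacityFlow (stmt-CriticalPhenomena-4981) and below the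
conjunct itself; combined with §6, under `AvoidanceLimit` the exponent of the crux is EXACTLY `5/8`. One further
registered stub (definition-free), LANDED as `Theorems/SAWFrontierHomotopyOneSidedPowerLawOfAvoidanceLimit.lean` (p158935). -/

/-- STUB 5 (S, necessity; definition-free) — CLOSED 2026-08-17 (lead c3, p158935,
`Theorems.OneSidedPowerLaw.Negative.stub_ofAvoidanceLimit`): **`AvoidanceLimit` ⇒ the crux body at `α = 5/8`.** -/
theorem stub_ofAvoidanceLimit : AvoidanceLimit →
    (∀ (D : DobrushinDomain) (a b : ℝ → Site 2), SAW.IsEndpointApprox D a b →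
      ∀ (D' : DobrushinDomain), (D'.carrier ⊆ D.carrier ∧ D'.pt 0 = D.pt 0 ∧ D'.pt 1 = D.pt 1 ∧
        D.pt 0 ∉ closure (D.carrier \ D'.carrier) ∧ D.pt 1 ∉ closure (D.carrier \ D'.carrier)) →
      ∀ (φ : ConformalEquiv upperHalfPlaneSet D.carrier), D.IsChordalUniformizing φ →
      (IsPlusHull (closure (upperHalfPlaneSet \ {z : ℂ | z ∈ upperHalfPlaneSet ∧ φ z ∈ D'.carrier})) ∨
        IsMinusHull (closure (upperHalfPlaneSet \ {z : ℂ | z ∈ upperHalfPlaneSet ∧ φ z ∈ D'.carrier}))) →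
      ∀ (Φ : ConformalEquiv (upperHalfPlaneSet \ closure (upperHalfPlaneSet \
          {z : ℂ | z ∈ upperHalfPlaneSet ∧ φ z ∈ D'.carrier})) upperHalfPlaneSet) (d : ℝ),
        IsRestrictionMap (closure (upperHalfPlaneSet \ {z : ℂ | z ∈ upperHalfPlaneSet ∧ φ z ∈ D'.carrier})) Φ →
        HasRestrictionDeriv (closure (upperHalfPlaneSet \ {z : ℂ | z ∈ upperHalfPlaneSet ∧ φ z ∈ D'.carrier})) Φ d →
        Tendsto (fun δ => ((SAW.law D.carrier δ (a δ) (b δ)).map (fun γ => γ.curve))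
          (CurveClass.rangeSubset (closure D'.carrier))) (𝓝[>] 0) (𝓝 (ENNReal.ofReal (d ^ ((5 : ℝ) / 8))))) :=
  -- LANDED (lead c3, p158935): `Theorems/SAWFrontierHomotopyOneSidedPowerLawOfAvoidanceLimit.lean`
  Theorems.OneSidedPowerLaw.Negative.stub_ofAvoidanceLimit

/-! By `Iff.rfl` this is `AvoidanceLimit → CruxBody (5/8)`. -/
example : AvoidanceLimit → CruxBody ((5 : ℝ) / 8) := stub_ofAvoidanceLimit

/-- **`AvoidanceLimit → OneSidedPowerLaw`** (α = 5/8): the crux closes in one line the moment stmt-4981 lands. -/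
theorem oneSidedPowerLaw_of_avoidanceLimit (h : AvoidanceLimit) : OneSidedPowerLaw := ⟨_, stub_ofAvoidanceLimit h⟩

/-- **`AvoidanceLimit → stub_plusPowerLaw`**: the open stub, too, is below stmt-4981. -/
theorem stub_plusPowerLaw_of_avoidanceLimit (h : AvoidanceLimit) : Registered.stub_plusPowerLaw :=
  plus_of_oneSided (oneSidedPowerLaw_of_avoidanceLimit h)

/-- **Under `AvoidanceLimit` the exponent of the crux is exactly `5/8`** (§6 uniqueness + §7 necessity). -/
theorem cruxBody_exponent_eq_of_avoidanceLimit (h : AvoidanceLimit) {α : ℝ} (hα : CruxBody α) : α = (5 : ℝ) / 8 :=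
  (stub_exponentRigidity _ (stub_ofAvoidanceLimit h)).2 α hα

/-- … and so is the exponent of the open stub: `AvoidanceLimit → PlusPowerLaw α → α = 5/8`. -/
theorem plusPowerLaw_exponent_eq_of_avoidanceLimit (h : AvoidanceLimit) {α : ℝ} (hP : PlusPowerLaw α) :
    α = (5 : ℝ) / 8 :=
  cruxBody_exponent_eq_of_avoidanceLimit h (cruxBody_of_plusPowerLaw hP)

/-! ## 8. Canonicity of the conformal data (lead c4, 2026-08-17): the `∀ (φ, Φ, d)` of the crux — and of
the open stub — is inessential bookkeeping. The lattice quantity `P_δ[range γ_δ ⊆ closure D']` depends on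
`(D, D', a, b)` only, while the body quantifies universally over the conformal data; were two admissible data of
one configuration to carry `d₁ ≠ d₂`, the crux (exponent `> 0`, §6) and the conjunct (§7) would both be refuted by
pure conformal geometry. One further REGISTERED stub (definition-free) closes this last soft refutation avenue:
two chordal uniformizers differ by a dilation (`IsChordalUniformizing.exists_eq_trans_smul_holds`), pulled-back
hulls and restriction maps are dilation-covariant with the same side and the same `Φ'(0)`. -/

/-- STUB 6 (S, negative knowledge; definition-free) — CLOSED 2026-08-17 (lead c4, p161413,
`Theorems.OneSidedPowerLaw.Negative.stub_datumCanonical`): **the conformal data are canonical** — for two chordal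
uniformizers `φ₁, φ₂` of `D` with `*`-hull pulled-back hull of `D'` under `φ₁`: the two pulled-back hulls have the
same side, and any restriction data `(Φ₁, d₁)`, `(Φ₂, d₂)` of them have `d₁ = d₂`.
[cite: LawlerSchrammWerner2003Restriction, Prop. 3.3 proof (p. 11)] -/
theorem stub_datumCanonical : ∀ (D D' : DobrushinDomain)
    (φ₁ φ₂ : ConformalEquiv upperHalfPlaneSet D.carrier),
    D.IsChordalUniformizing φ₁ → D.IsChordalUniformizing φ₂ →
    IsStarHull (closure (upperHalfPlaneSet \ {z : ℂ | z ∈ upperHalfPlaneSet ∧ φ₁ z ∈ D'.carrier})) →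
    ((IsPlusHull (closure (upperHalfPlaneSet \ {z : ℂ | z ∈ upperHalfPlaneSet ∧ φ₁ z ∈ D'.carrier})) ↔
        IsPlusHull (closure (upperHalfPlaneSet \ {z : ℂ | z ∈ upperHalfPlaneSet ∧ φ₂ z ∈ D'.carrier}))) ∧
      (IsMinusHull (closure (upperHalfPlaneSet \ {z : ℂ | z ∈ upperHalfPlaneSet ∧ φ₁ z ∈ D'.carrier})) ↔
        IsMinusHull (closure (upperHalfPlaneSet \ {z : ℂ | z ∈ upperHalfPlaneSet ∧ φ₂ z ∈ D'.carrier})))) ∧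
    ∀ (Φ₁ : ConformalEquiv (upperHalfPlaneSet \ closure (upperHalfPlaneSet \
        {z : ℂ | z ∈ upperHalfPlaneSet ∧ φ₁ z ∈ D'.carrier})) upperHalfPlaneSet)
      (Φ₂ : ConformalEquiv (upperHalfPlaneSet \ closure (upperHalfPlaneSet \
        {z : ℂ | z ∈ upperHalfPlaneSet ∧ φ₂ z ∈ D'.carrier})) upperHalfPlaneSet) (d₁ d₂ : ℝ),
      IsRestrictionMap (closure (upperHalfPlaneSet \ {z : ℂ | z ∈ upperHalfPlaneSet ∧ φ₁ z ∈ D'.carrier})) Φ₁ →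
      HasRestrictionDeriv (closure (upperHalfPlaneSet \ {z : ℂ | z ∈ upperHalfPlaneSet ∧ φ₁ z ∈ D'.carrier})) Φ₁ d₁ →
      IsRestrictionMap (closure (upperHalfPlaneSet \ {z : ℂ | z ∈ upperHalfPlaneSet ∧ φ₂ z ∈ D'.carrier})) Φ₂ →
      HasRestrictionDeriv (closure (upperHalfPlaneSet \ {z : ℂ | z ∈ upperHalfPlaneSet ∧ φ₂ z ∈ D'.carrier})) Φ₂ d₂ →
      d₁ = d₂ :=
  -- LANDED (lead c4, p161413): `Theorems/SAWFrontierHomotopyOneSidedPowerLawDatumCanonical.lean`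
  Theorems.OneSidedPowerLaw.Negative.stub_datumCanonical

/-! By the landed `oneSidedPowerLawExp_iff_exists_datum` (same file) the crux body at `α` is also equivalent to its form
with the restriction data quantified existentially; `CruxBody` here is `OneSidedPowerLawExp` there, by `Iff.rfl`. -/
example (α : ℝ) : CruxBody α ↔ Theorems.OneSidedPowerLaw.Negative.OneSidedPowerLawExp α := Iff.rfl

/-- **Transport of the open stub's conclusion between data**: under `PlusPowerLaw α`, for a configuration whose
pulled-back hull under ONE uniformizer `φ₁` is a plus-hull, the avoidance probabilities tend to `d₂ ^ α` for the
restriction data `(Φ₂, d₂)` of ANY other uniformizer `φ₂` (whose hull is then a plus-hull too). -/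
theorem PlusPowerLaw.tendsto_of_datum {α : ℝ} (hP : PlusPowerLaw α)
    {D : DobrushinDomain} {a b : ℝ → Site 2} (hab : SAW.IsEndpointApprox D a b) {D' : DobrushinDomain}
    (hsub : D'.carrier ⊆ D.carrier ∧ D'.pt 0 = D.pt 0 ∧ D'.pt 1 = D.pt 1 ∧
      D.pt 0 ∉ closure (D.carrier \ D'.carrier) ∧ D.pt 1 ∉ closure (D.carrier \ D'.carrier))
    {φ₁ φ₂ : ConformalEquiv upperHalfPlaneSet D.carrier} (h₁ : D.IsChordalUniformizing φ₁)
    (h₂ : D.IsChordalUniformizing φ₂)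
    (hplus : IsPlusHull (closure (upperHalfPlaneSet \ {z : ℂ | z ∈ upperHalfPlaneSet ∧ φ₁ z ∈ D'.carrier})))
    {Φ₂ : ConformalEquiv (upperHalfPlaneSet \ closure (upperHalfPlaneSet \
        {z : ℂ | z ∈ upperHalfPlaneSet ∧ φ₂ z ∈ D'.carrier})) upperHalfPlaneSet} {d₂ : ℝ}
    (hΦ₂ : IsRestrictionMap (closure (upperHalfPlaneSet \ {z : ℂ | z ∈ upperHalfPlaneSet ∧ φ₂ z ∈ D'.carrier})) Φ₂)
    (hd₂ : HasRestrictionDeriv (closure (upperHalfPlaneSet \ {z : ℂ | z ∈ upperHalfPlaneSet ∧ φ₂ z ∈ D'.carrier})) Φ₂ d₂) :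
    Tendsto (fun δ => ((SAW.law D.carrier δ (a δ) (b δ)).map (fun γ => γ.curve))
      (CurveClass.rangeSubset (closure D'.carrier))) (𝓝[>] 0) (𝓝 (ENNReal.ofReal (d₂ ^ α))) :=
  hP D a b hab D' hsub φ₂ h₂ ((stub_datumCanonical D D' φ₁ φ₂ h₁ h₂ hplus.1).1.1.1 hplus) Φ₂ d₂ hΦ₂ hd₂

end Summit.CriticalPhenomena.SAWScalingLimit.Cruxes.OneSidedPowerLaw.Birth

end
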